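import Summits.ResolutionOfSingularities.ResolutionOfSingularities.Theorems.DeltaCutRefCertificates4
import HarnessLib

/-!
# DeltaCutRefCertificates5 — decomp-res node «RefCut (certificates)» (lens-6 g27, critic row 204 CLEARED (F-curve
WHOLE) DECIDED +1 · MAP 0), tree file 5/5 of the node

Content VERBATIM from the decomp-res lens-6 g27 certificate file
`HOME/decomp-res-lens-6/g27/RefCutCertificates.lean` (pin 745ed495; ring level, imports the landed
`DeltaCutSepCertificates5`; namespace `…Theorems.DeltaCutClasses`, section `RefCertificates`); HOME =
run/shared/lean/pub/decomp-res; critic CRITIC-LEDGER row 204 CLEARED (F-curve WHOLE) DECIDED +1 · MAP 0; landing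
orders NEXT-g28.md §4 (F) + INBOX :1315 — provenance, critic text and the lens header in full in the first
certificate file `DeltaCutRefCertificates`.  `--kind proof --supports stmt-ResolutionOfSingularities-26971`.

## This file

Continuation 5/5 of `DeltaCutRefCertificates` (same namespace / sections of the node, cut at the tree's 400-line
cap; section variables / opens replayed): scopes `RefCertificates` — carries `Cx_D_muChart_h_top`,
`Cx_D_nuChart_X1`, `Cx_D_nuChart_X0`, `Cx_D_nuChart_X2`, `Cx_D_nuChart_X1_top`, `Cx_D_nuChart_X0_noTop`,
`Cx_D_nuChart_X2_top`, `Cx_R0_certificate`, `Cx_R1_certificate`, `Cx_R2_certificate`, `Cx_R3u_certificate`,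
`Cx_R3b_certificate`, `Cx_R4_certificate`, `Cx_R4nu_certificate`.

[WRITER NOTE (decomp-res writer g13): file split only (tree files ≤ 400 lines, cut at declaration boundaries);
namespace, the section `RefCertificates` with its `open MvPolynomial` / `variable {K : Type*} [Field K]`, and every
declaration exactly as in the lens (the HOME-only dupNamespace-linter line is dropped — the library sets it;
`noncomputable section`, the file-level `open` lines, `universe u` and `open …Rescue.BedZpeBinom4Centre
(mul_mem_pow_add)` are replayed in every part).]

(Sources: Hironaka1967; CossartJannsenSaito2020 Def. 3.13 / Thm. 3.14, Ch. 8, Thm. 9.6; Hironaka1970;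
CossartPiltant2019 Prop. 2.6; CossartPiltant2008 §2; Giraud1975; Hironaka2005; EGAIV4 §16–§18; StacksProject 0804 /
0BIQ / 031I / 039P; Matsumura1987 §28–§30; Kollar2007 Thm. 1.101.)
-/

noncomputable section

open CategoryTheory CategoryTheory.Limits AlgebraicGeometry TopologicalSpace IsLocalRing
open Literature.AlgebraicGeometry.Resolution

universe u

open Summit.ResolutionOfSingularities.ResolutionOfSingularities.Theorems.Rescue.BedZpeBinom4Centre (mul_mem_pow_add)

namespace Summit.ResolutionOfSingularities.ResolutionOfSingularities.Theorems.DeltaCutClasses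

open Summit.ResolutionOfSingularities.ResolutionOfSingularities.Theorems.TwistCutClasses
open Summit.ResolutionOfSingularities.ResolutionOfSingularities.Theorems.LightCutClasses

section RefCertificates

open MvPolynomial
variable {K : Type*} [Field K]

/-- **`μ`-chart `h` — top points only over `Q`**: every prime of order `≥ 3` for `α'³ + u'²·w'` contains `w'`
(`∂_{u'}∂_{u'}`: `2w'`) — off
the `Q`-fibres (`w'` a unit along `μ ∖ Q`) there is NO top point (the other `μ`-charts by (E) = P∞'s `w̃`-charts,
`Pinf_sepHeightOne_certificate` with `Pinf_symm`). [new; elementary] [folklore] -/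
theorem Cx_D_muChart_h_top [CharP K 3] (𝔮 : Ideal (MvPolynomial (Fin 4) K)) [𝔮.IsPrime] {s : MvPolynomial (Fin 4) K}
    (hs : s ∉ 𝔮) (h : s * (X 0 ^ 3 + X 2 ^ 2 * X 3 : MvPolynomial (Fin 4) K) ∈ 𝔮 ^ 3) : (X 3 : MvPolynomial (Fin 4) K) ∈ 𝔮 := by
  have hs2 : s ^ 2 ∉ 𝔮 := pow_not_mem 𝔮 hs 2
  have hs4 : (s ^ 2) ^ 2 ∉ 𝔮 := pow_not_mem 𝔮 hs2 2
  have h2 : (2 : MvPolynomial (Fin 4) K) ∉ 𝔮 := two_not_mem (K := K) 𝔮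
  have e20 := f_ne K (i := 2) (j := 0) (by decide)
  have e23 := f_ne K (i := 2) (j := 3) (by decide)
  have e22 := f_self K 2
  have d2 : pderiv 2 (X 0 ^ 3 + X 2 ^ 2 * X 3 : MvPolynomial (Fin 4) K) = 2 * (X 2 * X 3) := by
    simp only [map_add, Derivation.leibniz, Derivation.leibniz_pow, smul_eq_mul, nsmul_eq_mul, e20, e22, e23]
    push_cast; ring
  have d22 : pderiv 2 (2 * (X 2 * X 3) : MvPolynomial (Fin 4) K) = 2 * X 3 ^ 1 := by
    simp only [Derivation.leibniz, smul_eq_mul, e22, e23, f_two]; ring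
  have h2' := sq_mul_deriv_mem_pow 𝔮 h (pderiv 2)
  rw [d2] at h2'
  have h22 := sq_mul_deriv_mem_pow 𝔮 h2' (pderiv 2)
  rw [d22] at h22
  exact mem_of_mul_mul_pow_mem_pow 𝔮 one_ne_zero hs4 h2 h22

/-- `ν`-chart `b` (blow-up of `ν = V(α, b, γ)` in chart-`b` coordinates, `linChartSubst {0,1,2}` on `g₃'`):
`g₃'(α'b, b, γ'b, w') = b³·(α'³ + γ'·w'·(1 + γ'⁴b⁴))`. [new; elementary] [folklore] -/
theorem Cx_D_nuChart_X1 :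
    aeval (linChartSubst (K := K) {0, 1, 2} 1) (X 0 ^ 3 + X 1 ^ 2 * X 2 * X 3 * (1 + X 2 ^ 4) : MvPolynomial (Fin 4) K) =
      X 1 ^ 3 * (X 0 ^ 3 + X 2 * X 3 * (1 + X 2 ^ 4 * X 1 ^ 4)) := by
  simp [linChartSubst]; ring

/-- `ν`-chart `α`: `g₃'(α, b'α, γ'α, w') = α³·(1 + b'²·γ'·w'·(1 + γ'⁴α⁴))`. [new; elementary] [folklore] -/
theorem Cx_D_nuChart_X0 :
    aeval (linChartSubst (K := K) {0, 1, 2} 0) (X 0 ^ 3 + X 1 ^ 2 * X 2 * X 3 * (1 + X 2 ^ 4) : MvPolynomial (Fin 4) K) =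
      X 0 ^ 3 * (1 + X 1 ^ 2 * X 2 * X 3 * (1 + X 2 ^ 4 * X 0 ^ 4)) := by
  simp [linChartSubst]; ring

/-- `ν`-chart `γ`: `g₃'(α'γ, b'γ, γ, w') = γ³·(α'³ + b'²·w'·(1 + γ⁴))`. [new; elementary] [folklore] -/
theorem Cx_D_nuChart_X2 :
    aeval (linChartSubst (K := K) {0, 1, 2} 2) (X 0 ^ 3 + X 1 ^ 2 * X 2 * X 3 * (1 + X 2 ^ 4) : MvPolynomial (Fin 4) K) =
      X 2 ^ 3 * (X 0 ^ 3 + X 1 ^ 2 * X 3 * (1 + X 2 ^ 4)) := by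
  simp [linChartSubst]; ring

/-- **`ν`-chart `b` — top points only over `Q₀`**: every prime of order `≥ 3` for `α'³ + γ'w'(1+γ'⁴b⁴)` contains `w'` (`∂_{γ'}`:
`w'(1+5P) ∈ 𝔮`, `∂_{w'}`: `γ'(1+P) ∈ 𝔮`, `P = γ'⁴b⁴`; `w' ∉ 𝔮` would give `1+5P ∈ 𝔮` and `γ' ∈ 𝔮` (`1 ∈ 𝔮`) or `1+P
∈ 𝔮` (`4 ∈ 𝔮`)).
[new; elementary] [folklore] -/
theorem Cx_D_nuChart_X1_top [CharP K 3] (𝔮 : Ideal (MvPolynomial (Fin 4) K)) [𝔮.IsPrime] {s : MvPolynomial (Fin 4) K}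
    (hs : s ∉ 𝔮) (h : s * (X 0 ^ 3 + X 2 * X 3 * (1 + X 2 ^ 4 * X 1 ^ 4) : MvPolynomial (Fin 4) K) ∈ 𝔮 ^ 3) :
    (X 3 : MvPolynomial (Fin 4) K) ∈ 𝔮 := by
  have hs2 : s ^ 2 ∉ 𝔮 := pow_not_mem 𝔮 hs 2
  have h4 : (4 : MvPolynomial (Fin 4) K) ∉ 𝔮 := by
    have := natCast_not_mem (K := K) 𝔮 (m := 4) (by decide)
    exact_mod_cast this
  have e20 := f_ne K (i := 2) (j := 0) (by decide)
  have e21 := f_ne K (i := 2) (j := 1) (by decide)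
  have e23 := f_ne K (i := 2) (j := 3) (by decide)
  have e30 := f_ne K (i := 3) (j := 0) (by decide)
  have e31 := f_ne K (i := 3) (j := 1) (by decide)
  have e32 := f_ne K (i := 3) (j := 2) (by decide)
  have e22 := f_self K 2
  have e33 := f_self K 3
  have d2 : pderiv 2 (X 0 ^ 3 + X 2 * X 3 * (1 + X 2 ^ 4 * X 1 ^ 4) : MvPolynomial (Fin 4) K) = X 3 * (1 + 5 * (X 2 ^ 4 * X 1 ^ 4)) := by
    simp only [map_add, Derivation.leibniz, Derivation.leibniz_pow, smul_eq_mul, nsmul_eq_mul, e20, e21, e22, e23, f_one]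
    push_cast; ring
  have d3 : pderiv 3 (X 0 ^ 3 + X 2 * X 3 * (1 + X 2 ^ 4 * X 1 ^ 4) : MvPolynomial (Fin 4) K) = X 2 * (1 + X 2 ^ 4 * X 1 ^ 4) := by
    simp only [map_add, Derivation.leibniz, Derivation.leibniz_pow, smul_eq_mul, nsmul_eq_mul, e30, e31, e32, e33, f_one]
    push_cast; ring
  have h2 := sq_mul_deriv_mem_pow 𝔮 h (pderiv 2)
  rw [d2] at h2
  have h3 := sq_mul_deriv_mem_pow 𝔮 h (pderiv 3)
  rw [d3] at h3
  have hA : (X 3 * (1 + 5 * (X 2 ^ 4 * X 1 ^ 4)) : MvPolynomial (Fin 4) K) ∈ 𝔮 :=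
    (‹𝔮.IsPrime›.mem_or_mem (Ideal.pow_le_self two_ne_zero h2)).resolve_left hs2
  have hB : (X 2 * (1 + X 2 ^ 4 * X 1 ^ 4) : MvPolynomial (Fin 4) K) ∈ 𝔮 :=
    (‹𝔮.IsPrime›.mem_or_mem (Ideal.pow_le_self two_ne_zero h3)).resolve_left hs2
  by_contra hX3
  have hA' : (1 + 5 * (X 2 ^ 4 * X 1 ^ 4) : MvPolynomial (Fin 4) K) ∈ 𝔮 := (‹𝔮.IsPrime›.mem_or_mem hA).resolve_left hX3
  rcases ‹𝔮.IsPrime›.mem_or_mem hB with hγ | hP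
  · have h1mem : (1 : MvPolynomial (Fin 4) K) ∈ 𝔮 := by
      have := Ideal.sub_mem _ hA' (Ideal.mul_mem_left _ (5 * (X 2 ^ 3 * X 1 ^ 4)) hγ)
      rwa [show (1 + 5 * (X 2 ^ 4 * X 1 ^ 4) - 5 * (X 2 ^ 3 * X 1 ^ 4) * X 2 : MvPolynomial (Fin 4) K) = 1 by ring] at this
    exact one_not_mem_of_isPrime 𝔮 h1mem
  · have h4mem : (4 : MvPolynomial (Fin 4) K) ∈ 𝔮 := by
      have := Ideal.sub_mem _ (Ideal.mul_mem_left _ 5 hP) hA'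
      rwa [show (5 * (1 + X 2 ^ 4 * X 1 ^ 4) - (1 + 5 * (X 2 ^ 4 * X 1 ^ 4)) : MvPolynomial (Fin 4) K) = 4 by ring] at this
    exact h4 h4mem

/-- **`ν`-chart `α` — NO top point**: `1 + b'²γ'w'(1+γ'⁴α⁴)` (`∂_{w'}`: `b'²γ'(1+γ'⁴α⁴) ∈ 𝔮`, then `1 ∈ 𝔮`). [new;
elementary] [folklore] -/
theorem Cx_D_nuChart_X0_noTop (𝔮 : Ideal (MvPolynomial (Fin 4) K)) [𝔮.IsPrime] {s : MvPolynomial (Fin 4) K} (hs : s ∉ 𝔮)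
    (h : s * (1 + X 1 ^ 2 * X 2 * X 3 * (1 + X 2 ^ 4 * X 0 ^ 4) : MvPolynomial (Fin 4) K) ∈ 𝔮 ^ 3) : False := by
  have hs2 : s ^ 2 ∉ 𝔮 := pow_not_mem 𝔮 hs 2
  have e30 := f_ne K (i := 3) (j := 0) (by decide)
  have e31 := f_ne K (i := 3) (j := 1) (by decide)
  have e32 := f_ne K (i := 3) (j := 2) (by decide)
  have e33 := f_self K 3
  have d3 : pderiv 3 (1 + X 1 ^ 2 * X 2 * X 3 * (1 + X 2 ^ 4 * X 0 ^ 4) : MvPolynomial (Fin 4) K) =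
      X 1 ^ 2 * X 2 * (1 + X 2 ^ 4 * X 0 ^ 4) := by
    simp only [map_add, Derivation.leibniz, Derivation.leibniz_pow, smul_eq_mul, nsmul_eq_mul, e30, e31, e32, e33, f_one]
    push_cast; ring
  have h3 := sq_mul_deriv_mem_pow 𝔮 h (pderiv 3)
  rw [d3] at h3
  have hk : (X 1 ^ 2 * X 2 * (1 + X 2 ^ 4 * X 0 ^ 4) : MvPolynomial (Fin 4) K) ∈ 𝔮 :=
    (‹𝔮.IsPrime›.mem_or_mem (Ideal.pow_le_self two_ne_zero h3)).resolve_left hs2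
  have hf : (1 + X 1 ^ 2 * X 2 * X 3 * (1 + X 2 ^ 4 * X 0 ^ 4) : MvPolynomial (Fin 4) K) ∈ 𝔮 := mem_of_sMul_mem_cube 𝔮 hs h
  have h1mem : (1 : MvPolynomial (Fin 4) K) ∈ 𝔮 := by
    have := Ideal.sub_mem _ hf (Ideal.mul_mem_left _ (X 3) hk)
    rwa [show (1 + X 1 ^ 2 * X 2 * X 3 * (1 + X 2 ^ 4 * X 0 ^ 4) - X 3 * (X 1 ^ 2 * X 2 * (1 + X 2 ^ 4 * X 0 ^ 4)) :
      MvPolynomial (Fin 4) K) = 1 by ring] at this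
  exact one_not_mem_of_isPrime 𝔮 h1mem

/-- **`ν`-chart `γ` — top points only over `Q₀` or on `μ`** (away from `ν`): every prime of order `≥ 3` for `α'³ +
b'²w'(1+γ⁴)` contains
`w'` or `1+γ⁴` (`∂_{b'}∂_{b'}`: `2w'(1+γ⁴)`). [new; elementary] [folklore] -/
theorem Cx_D_nuChart_X2_top [CharP K 3] (𝔮 : Ideal (MvPolynomial (Fin 4) K)) [𝔮.IsPrime] {s : MvPolynomial (Fin 4) K}
    (hs : s ∉ 𝔮) (h : s * (X 0 ^ 3 + X 1 ^ 2 * X 3 * (1 + X 2 ^ 4) : MvPolynomial (Fin 4) K) ∈ 𝔮 ^ 3) :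
    (X 3 : MvPolynomial (Fin 4) K) ∈ 𝔮 ∨ (1 + X 2 ^ 4 : MvPolynomial (Fin 4) K) ∈ 𝔮 := by
  have hs2 : s ^ 2 ∉ 𝔮 := pow_not_mem 𝔮 hs 2
  have hs4 : (s ^ 2) ^ 2 ∉ 𝔮 := pow_not_mem 𝔮 hs2 2
  have h2 : (2 : MvPolynomial (Fin 4) K) ∉ 𝔮 := two_not_mem (K := K) 𝔮
  have e10 := f_ne K (i := 1) (j := 0) (by decide)
  have e12 := f_ne K (i := 1) (j := 2) (by decide)
  have e13 := f_ne K (i := 1) (j := 3) (by decide)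
  have e11 := f_self K 1
  have d1 : pderiv 1 (X 0 ^ 3 + X 1 ^ 2 * X 3 * (1 + X 2 ^ 4) : MvPolynomial (Fin 4) K) = 2 * (X 1 * X 3 * (1 + X 2 ^ 4)) := by
    simp only [map_add, Derivation.leibniz, Derivation.leibniz_pow, smul_eq_mul, nsmul_eq_mul, e10, e11, e12, e13, f_one]
    push_cast; ring
  have d11 : pderiv 1 (2 * (X 1 * X 3 * (1 + X 2 ^ 4)) : MvPolynomial (Fin 4) K) = 2 * (X 3 * (1 + X 2 ^ 4)) := by
    simp only [map_add, Derivation.leibniz, Derivation.leibniz_pow, smul_eq_mul, nsmul_eq_mul, e11, e12, e13, f_one, f_two]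
    push_cast; ring
  have h1 := sq_mul_deriv_mem_pow 𝔮 h (pderiv 1)
  rw [d1] at h1
  have h11 := sq_mul_deriv_mem_pow 𝔮 h1 (pderiv 1)
  rw [d11, pow_one] at h11
  rcases ‹𝔮.IsPrime›.mem_or_mem h11 with h' | h'
  · exact absurd h' hs4
  exact ‹𝔮.IsPrime›.mem_or_mem ((‹𝔮.IsPrime›.mem_or_mem h').resolve_left h2)

/-! #### THE LEVEL CERTIFICATES OF C× UNDER THE REFINED LAW (conjunctions, `char K = 3`; read with the dictionary above)

`RefTerminates 3 ⟨(𝔸⁴, (z³ + t⁴ + u⁴w⁴)), none⟩` at refined height 4 — the DECIDED CELL `WORTopSepHeavyRefTame 3` IS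
INHABITED by the
g26 kind-F inhabitant; C× is neither F-surface nor P′.  One theorem per refined level (a single conjunction of all
five exceeds the
elaborator's default budget and adds nothing). -/

/-- **C× · R0** — bad₀ closure `C = V(z,t,uw)`: NOT regular at the origin (`Cx_closure_not_prime`, cited), its two
lines meet EXACTLY
there (`Sing C = {0}`): `CurveFrozen`; the refined hop RESOLVES with centre the origin, pending `C̃`; `u ↔ w`
symmetry. [new] [folklore] -/
theorem Cx_R0_certificate :
    Ideal.span {(X 0 : MvPolynomial (Fin 4) K), X 1, X 3} ⊔ Ideal.span {(X 0 : MvPolynomial (Fin 4) K), X 1, X 2} =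
        Ideal.span {(X 0 : MvPolynomial (Fin 4) K), X 1, X 2, X 3} ∧
      ((X 2 * X 3 : MvPolynomial (Fin 4) K) ∈
          Ideal.span {(X 0 : MvPolynomial (Fin 4) K), X 1, X 3} ⊓ Ideal.span {(X 0 : MvPolynomial (Fin 4) K), X 1, X 2} ∧
        (X 2 : MvPolynomial (Fin 4) K) ∉
          Ideal.span {(X 0 : MvPolynomial (Fin 4) K), X 1, X 3} ⊓ Ideal.span {(X 0 : MvPolynomial (Fin 4) K), X 1, X 2} ∧
        (X 3 : MvPolynomial (Fin 4) K) ∉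
          Ideal.span {(X 0 : MvPolynomial (Fin 4) K), X 1, X 3} ⊓ Ideal.span {(X 0 : MvPolynomial (Fin 4) K), X 1, X 2}) ∧
      rename (Equiv.swap (2 : Fin 4) 3) (X 0 ^ 3 + X 1 ^ 4 + X 2 ^ 4 * X 3 ^ 4 : MvPolynomial (Fin 4) K) =
        X 0 ^ 3 + X 1 ^ 4 + X 2 ^ 4 * X 3 ^ 4 :=
  ⟨Cx_sing_closure, Cx_closure_not_prime, Cx_symm⟩

/-- **C× · R0 → R1** (point charts `z` / `t` / `u`; `w` by symmetry): no top point in charts `z`, `t`; in chart `u`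
top = bad = `ℓ_u ∪ ũ`
(both lines, in the top locus, wild: `r ∈ P⁴`, near everywhere) — closure bad₁ is the nodal chain `ũ ∪ L ∪ w̃`, but
the PENDING `C̃ = ũ ⊔ w̃`
is regular (R): the refined hop EXITS (blow up `C̃`). [new] [folklore] -/
theorem Cx_R1_certificate [CharP K 3] :
    aeval (chartSubst (K := K) 0) (X 0 ^ 3 + X 1 ^ 4 + X 2 ^ 4 * X 3 ^ 4 : MvPolynomial (Fin 4) K) =
        X 0 ^ 3 * (1 + X 0 * (X 1 ^ 4 + X 0 ^ 4 * X 2 ^ 4 * X 3 ^ 4)) ∧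
      aeval (chartSubst (K := K) 1) (X 0 ^ 3 + X 1 ^ 4 + X 2 ^ 4 * X 3 ^ 4 : MvPolynomial (Fin 4) K) =
        X 1 ^ 3 * (X 0 ^ 3 + X 1 * (1 + X 1 ^ 4 * X 2 ^ 4 * X 3 ^ 4)) ∧
      aeval (chartSubst (K := K) 2) (X 0 ^ 3 + X 1 ^ 4 + X 2 ^ 4 * X 3 ^ 4 : MvPolynomial (Fin 4) K) =
        X 2 ^ 3 * (X 0 ^ 3 + X 2 * X 1 ^ 4 + X 2 ^ 5 * X 3 ^ 4) ∧
      (∀ (𝔮 : Ideal (MvPolynomial (Fin 4) K)) [𝔮.IsPrime], ∀ s ∉ 𝔮,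
        s * (1 + X 0 * (X 1 ^ 4 + X 0 ^ 4 * X 2 ^ 4 * X 3 ^ 4) : MvPolynomial (Fin 4) K) ∈ 𝔮 ^ 3 → False) ∧
      (∀ (𝔮 : Ideal (MvPolynomial (Fin 4) K)) [𝔮.IsPrime], ∀ s ∉ 𝔮,
        s * (X 0 ^ 3 + X 1 * (1 + X 1 ^ 4 * X 2 ^ 4 * X 3 ^ 4) : MvPolynomial (Fin 4) K) ∈ 𝔮 ^ 3 → False) ∧
      (∀ (𝔮 : Ideal (MvPolynomial (Fin 4) K)) [𝔮.IsPrime], ∀ s ∉ 𝔮,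
        s * (X 0 ^ 3 + X 2 * X 1 ^ 4 + X 2 ^ 5 * X 3 ^ 4 : MvPolynomial (Fin 4) K) ∈ 𝔮 ^ 3 →
          (X 0 : MvPolynomial (Fin 4) K) ∈ 𝔮 ∧ (X 1 : MvPolynomial (Fin 4) K) ∈ 𝔮 ∧
            ((X 2 : MvPolynomial (Fin 4) K) ∈ 𝔮 ∨ (X 3 : MvPolynomial (Fin 4) K) ∈ 𝔮)) ∧
      (((X 0 ^ 3 + X 2 * X 1 ^ 4 + X 2 ^ 5 * X 3 ^ 4 : MvPolynomial (Fin 4) K) ∈ (Ideal.span {(X 0 : MvPolynomial (Fin 4) K), X 1, X 2}) ^ 3 ∧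
          (X 0 ^ 3 + X 2 * X 1 ^ 4 + X 2 ^ 5 * X 3 ^ 4 : MvPolynomial (Fin 4) K) ∈ (Ideal.span {(X 0 : MvPolynomial (Fin 4) K), X 1, X 3}) ^ 3) ∧
        ((X 3 : MvPolynomial (Fin 4) K) ∉ Ideal.span {(X 0 : MvPolynomial (Fin 4) K), X 1, X 2} ∧
          (X 2 : MvPolynomial (Fin 4) K) ∉ Ideal.span {(X 0 : MvPolynomial (Fin 4) K), X 1, X 3}) ∧
        ((X 2 * X 1 ^ 4 + X 2 ^ 5 * X 3 ^ 4 : MvPolynomial (Fin 4) K) ∈ (Ideal.span {(X 0 : MvPolynomial (Fin 4) K), X 1, X 2}) ^ 5 ∧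
          (X 2 * X 1 ^ 4 + X 2 ^ 5 * X 3 ^ 4 : MvPolynomial (Fin 4) K) ∈ (Ideal.span {(X 0 : MvPolynomial (Fin 4) K), X 1, X 3}) ^ 4)) ∧
      ((∀ E : MvPolynomial (Fin 4) K, (X 0 ^ 3 + X 2 * X 1 ^ 2 * E : MvPolynomial (Fin 4) K) ∈
          (Ideal.span {(X 0 : MvPolynomial (Fin 4) K), X 1, X 2, X 3}) ^ 3) ∧
        ∀ E H : MvPolynomial (Fin 4) K, (X 0 ^ 3 + X 2 * E * (X 1 ^ 4 + H * X 3 ^ 4) : MvPolynomial (Fin 4) K) ∈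
          (Ideal.span {(X 0 : MvPolynomial (Fin 4) K), X 1, X 2, X 3}) ^ 3) :=
  ⟨Cx_A_chart_z, Cx_A_chart_t, Cx_A_chart_u, fun 𝔮 _ _ hs h => Cx_A_chart_z_noTop 𝔮 hs h, fun 𝔮 _ _ hs h => Cx_A_chart_t_noTop 𝔮 hs h,
    fun 𝔮 _ _ hs h => Cx_A_chart_u_top 𝔮 hs h, Cx_A_chart_u_lines, Cx_A_near⟩

/-- **C× · R1 → R2** (line charts `z'` / `t'` / `w'` of `ũ`): no top point in charts `z'`, `t'`; in chart `w'` top =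
bad = the line `m = L̃`
(`g₂ ∈ P_m³`, `w' ∉ P_m`, `r ∈ P_m⁵`: wild, near): bad₂ = `L̃` regular, nothing pending: SEPARATING-ACTIVE, step 1 =
`L̃`, step 2 empty.
[new] [folklore] -/
theorem Cx_R2_certificate [CharP K 3] :
    aeval (linChartSubst (K := K) {0, 1, 3} 0) (X 0 ^ 3 + X 2 * X 1 ^ 4 + X 2 ^ 5 * X 3 ^ 4 : MvPolynomial (Fin 4) K) =
        X 0 ^ 3 * (1 + X 0 * X 2 * (X 1 ^ 4 + X 2 ^ 4 * X 3 ^ 4)) ∧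
      aeval (linChartSubst (K := K) {0, 1, 3} 1) (X 0 ^ 3 + X 2 * X 1 ^ 4 + X 2 ^ 5 * X 3 ^ 4 : MvPolynomial (Fin 4) K) =
        X 1 ^ 3 * (X 0 ^ 3 + X 1 * X 2 * (1 + X 2 ^ 4 * X 3 ^ 4)) ∧
      aeval (linChartSubst (K := K) {0, 1, 3} 3) (X 0 ^ 3 + X 2 * X 1 ^ 4 + X 2 ^ 5 * X 3 ^ 4 : MvPolynomial (Fin 4) K) =
        X 3 ^ 3 * (X 0 ^ 3 + X 2 * X 3 * (X 1 ^ 4 + X 2 ^ 4)) ∧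
      (∀ (𝔮 : Ideal (MvPolynomial (Fin 4) K)) [𝔮.IsPrime], ∀ s ∉ 𝔮,
        s * (1 + X 0 * X 2 * (X 1 ^ 4 + X 2 ^ 4 * X 3 ^ 4) : MvPolynomial (Fin 4) K) ∈ 𝔮 ^ 3 → False) ∧
      (∀ (𝔮 : Ideal (MvPolynomial (Fin 4) K)) [𝔮.IsPrime], ∀ s ∉ 𝔮,
        s * (X 0 ^ 3 + X 1 * X 2 * (1 + X 2 ^ 4 * X 3 ^ 4) : MvPolynomial (Fin 4) K) ∈ 𝔮 ^ 3 → False) ∧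
      (∀ (𝔮 : Ideal (MvPolynomial (Fin 4) K)) [𝔮.IsPrime], ∀ s ∉ 𝔮,
        s * (X 0 ^ 3 + X 2 * X 3 * (X 1 ^ 4 + X 2 ^ 4) : MvPolynomial (Fin 4) K) ∈ 𝔮 ^ 3 →
          (X 0 : MvPolynomial (Fin 4) K) ∈ 𝔮 ∧ (X 1 : MvPolynomial (Fin 4) K) ∈ 𝔮 ∧ (X 2 : MvPolynomial (Fin 4) K) ∈ 𝔮) ∧
      ((X 0 ^ 3 + X 2 * X 3 * (X 1 ^ 4 + X 2 ^ 4) : MvPolynomial (Fin 4) K) ∈ (Ideal.span {(X 0 : MvPolynomial (Fin 4) K), X 1, X 2}) ^ 3 ∧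
        (X 3 : MvPolynomial (Fin 4) K) ∉ Ideal.span {(X 0 : MvPolynomial (Fin 4) K), X 1, X 2} ∧
        (X 2 * X 3 * (X 1 ^ 4 + X 2 ^ 4) : MvPolynomial (Fin 4) K) ∈ (Ideal.span {(X 0 : MvPolynomial (Fin 4) K), X 1, X 2}) ^ 5) :=
  ⟨Cx_B_lineChart_X0, Cx_B_lineChart_X1, Cx_B_lineChart_X3, fun 𝔮 _ _ hs h => Cx_B_lineChart_X0_noTop 𝔮 hs h,
    fun 𝔮 _ _ hs h => Cx_B_lineChart_X1_noTop 𝔮 hs h, fun 𝔮 _ _ hs h => Cx_B_lineChart_X3_top 𝔮 hs h, Cx_B_lineChart_X3_line⟩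

/-- **C× · R2 → R3, chart `u`** (line charts `a` / `u` of `L̃`): chart `a` no top point; chart `u`: top = `λ ∪ μ`
(both curves in the top locus),
`∂_u∂_u g₃ = 2·w'h`, TAME along `λ ∖ {h=0}` and `μ ∖ {w'=0}`, `h` separable (`β ∉ 𝔮 ∋ h`), WILD and NEAR at `Q`, and
`g₃ = P∞(α, h, u, w')`.
[new] [folklore] -/
theorem Cx_R3u_certificate [CharP K 3] :
    aeval (linChartSubst (K := K) {0, 1, 2} 0) (X 0 ^ 3 + X 2 * X 3 * (X 1 ^ 4 + X 2 ^ 4) : MvPolynomial (Fin 4) K) =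
        X 0 ^ 3 * (1 + X 0 ^ 2 * X 2 * X 3 * (X 1 ^ 4 + X 2 ^ 4)) ∧
      aeval (linChartSubst (K := K) {0, 1, 2} 2) (X 0 ^ 3 + X 2 * X 3 * (X 1 ^ 4 + X 2 ^ 4) : MvPolynomial (Fin 4) K) =
        X 2 ^ 3 * (X 0 ^ 3 + X 2 ^ 2 * X 3 * (X 1 ^ 4 + 1)) ∧
      (∀ (𝔮 : Ideal (MvPolynomial (Fin 4) K)) [𝔮.IsPrime], ∀ s ∉ 𝔮,
        s * (1 + X 0 ^ 2 * X 2 * X 3 * (X 1 ^ 4 + X 2 ^ 4) : MvPolynomial (Fin 4) K) ∈ 𝔮 ^ 3 → False) ∧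
      (∀ (𝔮 : Ideal (MvPolynomial (Fin 4) K)) [𝔮.IsPrime], ∀ s ∉ 𝔮,
        s * (X 0 ^ 3 + X 2 ^ 2 * X 3 * (X 1 ^ 4 + 1) : MvPolynomial (Fin 4) K) ∈ 𝔮 ^ 3 →
          (X 0 : MvPolynomial (Fin 4) K) ∈ 𝔮 ∧ (X 2 : MvPolynomial (Fin 4) K) ∈ 𝔮 ∧
            ((X 3 : MvPolynomial (Fin 4) K) ∈ 𝔮 ∨ (X 1 ^ 4 + 1 : MvPolynomial (Fin 4) K) ∈ 𝔮)) ∧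
      ((X 0 ^ 3 + X 2 ^ 2 * X 3 * (X 1 ^ 4 + 1) : MvPolynomial (Fin 4) K) ∈ (Ideal.span {(X 0 : MvPolynomial (Fin 4) K), X 2, X 3}) ^ 3 ∧
        (X 0 ^ 3 + X 2 ^ 2 * X 3 * (X 1 ^ 4 + 1) : MvPolynomial (Fin 4) K) ∈
          (Ideal.span {(X 0 : MvPolynomial (Fin 4) K), X 2, X 1 ^ 4 + 1}) ^ 3 ∧
        (X 1 : MvPolynomial (Fin 4) K) ∉ Ideal.span {(X 0 : MvPolynomial (Fin 4) K), X 2, X 3} ∧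
        (X 3 : MvPolynomial (Fin 4) K) ∉ Ideal.span {(X 0 : MvPolynomial (Fin 4) K), X 2, X 1 ^ 4 + 1}) ∧
      (pderiv 2) ((pderiv 2) (X 0 ^ 3 + X 2 ^ 2 * X 3 * (X 1 ^ 4 + 1) : MvPolynomial (Fin 4) K)) = 2 * (X 3 * (X 1 ^ 4 + 1)) ∧
      (∀ (𝔫 : Ideal (MvPolynomial (Fin 4) K)) [𝔫.IsPrime], (X 3 : MvPolynomial (Fin 4) K) ∈ 𝔫 →
        (X 1 ^ 4 + 1 : MvPolynomial (Fin 4) K) ∉ 𝔫 → ∀ s' ∉ 𝔫, s' * (X 3 * (X 1 ^ 4 + 1) : MvPolynomial (Fin 4) K) ∉ 𝔫 ^ 2) ∧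
      (∀ (𝔫 : Ideal (MvPolynomial (Fin 4) K)) [𝔫.IsPrime], (X 1 ^ 4 + 1 : MvPolynomial (Fin 4) K) ∈ 𝔫 →
        (X 3 : MvPolynomial (Fin 4) K) ∉ 𝔫 → ∀ s' ∉ 𝔫, s' * (X 3 * (X 1 ^ 4 + 1) : MvPolynomial (Fin 4) K) ∉ 𝔫 ^ 2) ∧
      (∀ (𝔮 : Ideal (MvPolynomial (Fin 4) K)) [𝔮.IsPrime], (X 1 ^ 4 + 1 : MvPolynomial (Fin 4) K) ∈ 𝔮 → (X 1 : MvPolynomial (Fin 4) K) ∉ 𝔮) ∧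
      ((X 2 ^ 2 * X 3 * (X 1 ^ 4 + 1) : MvPolynomial (Fin 4) K) ∈ (Ideal.span {(X 0 : MvPolynomial (Fin 4) K), X 2, X 3, X 1 ^ 4 + 1}) ^ 4 ∧
        ∀ E : MvPolynomial (Fin 4) K, (X 0 ^ 3 + X 2 * X 3 * X 1 * E : MvPolynomial (Fin 4) K) ∈
          (Ideal.span {(X 0 : MvPolynomial (Fin 4) K), X 1, X 2, X 3}) ^ 3) ∧
      aeval (fun j : Fin 4 => if j = 1 then (X 1 ^ 4 + 1 : MvPolynomial (Fin 4) K) else X j)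
          (X 0 ^ 3 + X 1 * X 2 ^ 2 * X 3 : MvPolynomial (Fin 4) K) = X 0 ^ 3 + X 2 ^ 2 * X 3 * (X 1 ^ 4 + 1) :=
  ⟨Cx_C_lineChart_X0, Cx_C_lineChart_X2, fun 𝔮 _ _ hs h => Cx_C_lineChart_X0_noTop 𝔮 hs h, fun 𝔮 _ _ hs h => Cx_C_lineChart_X2_top 𝔮 hs h,
    Cx_C_curves, Cx_C_dd, fun 𝔫 _ h3 hh => (Cx_C_tame_lambda 𝔫 h3 hh).2, fun 𝔫 _ hh h3 => (Cx_C_tame_mu 𝔫 hh h3).2,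
    fun 𝔮 _ hh => (Cx_h_separable 𝔮 hh).2.1, Cx_C_wild_near_Q, Cx_C_isPinf⟩

/-- **C× · R2 → R3, chart `b`**: top = `ν ∪ λ ∪ μ` (`ν`, `λ` lines in the top locus), `∂_b∂_b g₃' = 2·γw'(1+γ⁴)`,
TAME along `ν ∖ {w'=0}`,
`γ(1+γ⁴)` an étale coordinate along `ν`, WILD and NEAR at `Q₀` (point chart `b`), and `g₃' = P∞(α, γ(1+γ⁴), b, w')`.
 With `Cx_R3u_certificate`
and the mirror: bad₃ = `{Q} ∪ {Q₀} ∪ mirror` finite nonempty, closure regular: SEPARATING-ACTIVE, step 1 = the bad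
points, step 2 =
`λ̃ ⊔ λ̃' ⊔ (μ ∪ ν)~` (disjoint regular: fires). [new] [folklore] -/
theorem Cx_R3b_certificate [CharP K 3] :
    aeval (linChartSubst (K := K) {0, 1, 2} 1) (X 0 ^ 3 + X 2 * X 3 * (X 1 ^ 4 + X 2 ^ 4) : MvPolynomial (Fin 4) K) =
        X 1 ^ 3 * (X 0 ^ 3 + X 1 ^ 2 * X 2 * X 3 * (1 + X 2 ^ 4)) ∧
      (∀ (𝔮 : Ideal (MvPolynomial (Fin 4) K)) [𝔮.IsPrime], ∀ s ∉ 𝔮,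
        s * (X 0 ^ 3 + X 1 ^ 2 * X 2 * X 3 * (1 + X 2 ^ 4) : MvPolynomial (Fin 4) K) ∈ 𝔮 ^ 3 →
          (X 0 : MvPolynomial (Fin 4) K) ∈ 𝔮 ∧ (X 1 : MvPolynomial (Fin 4) K) ∈ 𝔮 ∧
            ((X 2 : MvPolynomial (Fin 4) K) ∈ 𝔮 ∨ (X 3 : MvPolynomial (Fin 4) K) ∈ 𝔮 ∨ (1 + X 2 ^ 4 : MvPolynomial (Fin 4) K) ∈ 𝔮)) ∧
      ((X 0 ^ 3 + X 1 ^ 2 * X 2 * X 3 * (1 + X 2 ^ 4) : MvPolynomial (Fin 4) K) ∈ (Ideal.span {(X 0 : MvPolynomial (Fin 4) K), X 1, X 2}) ^ 3 ∧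
        (X 3 : MvPolynomial (Fin 4) K) ∉ Ideal.span {(X 0 : MvPolynomial (Fin 4) K), X 1, X 2} ∧
        (X 0 ^ 3 + X 1 ^ 2 * X 2 * X 3 * (1 + X 2 ^ 4) : MvPolynomial (Fin 4) K) ∈
          (Ideal.span {(X 0 : MvPolynomial (Fin 4) K), X 1, X 3}) ^ 3 ∧
        (X 2 : MvPolynomial (Fin 4) K) ∉ Ideal.span {(X 0 : MvPolynomial (Fin 4) K), X 1, X 3}) ∧
      (pderiv 1) ((pderiv 1) (X 0 ^ 3 + X 1 ^ 2 * X 2 * X 3 * (1 + X 2 ^ 4) : MvPolynomial (Fin 4) K)) = 2 * (X 2 * X 3 * (1 + X 2 ^ 4)) ∧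
      (∀ (𝔫 : Ideal (MvPolynomial (Fin 4) K)) [𝔫.IsPrime], (X 2 : MvPolynomial (Fin 4) K) ∈ 𝔫 → (X 3 : MvPolynomial (Fin 4) K) ∉ 𝔫 →
        ∀ s' ∉ 𝔫, s' * (X 2 * X 3 * (1 + X 2 ^ 4) : MvPolynomial (Fin 4) K) ∉ 𝔫 ^ 2) ∧
      (∀ (𝔮 : Ideal (MvPolynomial (Fin 4) K)) [𝔮.IsPrime], (X 2 : MvPolynomial (Fin 4) K) ∈ 𝔮 →
        pderiv 2 (X 2 * (1 + X 2 ^ 4) : MvPolynomial (Fin 4) K) = 1 + 5 * X 2 ^ 4 ∧ (1 + 5 * X 2 ^ 4 : MvPolynomial (Fin 4) K) ∉ 𝔮) ∧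
      ((X 1 ^ 2 * X 2 * X 3 * (1 + X 2 ^ 4) : MvPolynomial (Fin 4) K) ∈ (Ideal.span {(X 0 : MvPolynomial (Fin 4) K), X 1, X 2, X 3}) ^ 4 ∧
        aeval (chartSubst (K := K) 1) (X 0 ^ 3 + X 1 ^ 2 * X 2 * X 3 * (1 + X 2 ^ 4) : MvPolynomial (Fin 4) K) =
          X 1 ^ 3 * (X 0 ^ 3 + X 1 * X 2 * X 3 * (1 + X 2 ^ 4 * X 1 ^ 4)) ∧
        (X 0 ^ 3 + X 1 * X 2 * X 3 * (1 + X 2 ^ 4 * X 1 ^ 4) : MvPolynomial (Fin 4) K) ∈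
          (Ideal.span {(X 0 : MvPolynomial (Fin 4) K), X 1, X 2, X 3}) ^ 3) ∧
      aeval (fun j : Fin 4 => if j = 1 then (X 2 * (1 + X 2 ^ 4) : MvPolynomial (Fin 4) K) else if j = 2 then X 1 else X j)
          (X 0 ^ 3 + X 1 * X 2 ^ 2 * X 3 : MvPolynomial (Fin 4) K) = X 0 ^ 3 + X 1 ^ 2 * X 2 * X 3 * (1 + X 2 ^ 4) :=
  ⟨Cx_C_lineChart_X1, fun 𝔮 _ _ hs h => Cx_C_lineChart_X1_top 𝔮 hs h, Cx_C_nu_lines, Cx_C_dd_b, fun 𝔫 _ hγ h3 => (Cx_C_tame_nu 𝔫 hγ h3).2,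
    fun 𝔮 _ hγ => Cx_gamma_separable 𝔮 hγ, Cx_C_wild_near_Q0, Cx_C_isPinf_b⟩

/-- **C× · R3 → R4 off the bad fibres, `λ`- and `μ`-charts** (over `Q`, `Q₀`: P∞'s `Pinf_sepHeightOne_certificate`
through (E), cited):
`λ`-charts `u` / `w'` / `α` (top only over `Q`), `μ`-chart `h` (top only over `Q`): NO top point over `λ ∖ {Q,Q₀}`,
`μ ∖ Q`. [new] [folklore] -/
theorem Cx_R4_certificate [CharP K 3] :
    (aeval (linChartSubst (K := K) {0, 2, 3} 2) (X 0 ^ 3 + X 2 ^ 2 * X 3 * (X 1 ^ 4 + 1) : MvPolynomial (Fin 4) K) =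
          X 2 ^ 3 * (X 0 ^ 3 + X 3 * (X 1 ^ 4 + 1)) ∧
        aeval (linChartSubst (K := K) {0, 2, 3} 3) (X 0 ^ 3 + X 2 ^ 2 * X 3 * (X 1 ^ 4 + 1) : MvPolynomial (Fin 4) K) =
          X 3 ^ 3 * (X 0 ^ 3 + X 2 ^ 2 * (X 1 ^ 4 + 1)) ∧
        aeval (linChartSubst (K := K) {0, 2, 3} 0) (X 0 ^ 3 + X 2 ^ 2 * X 3 * (X 1 ^ 4 + 1) : MvPolynomial (Fin 4) K) =
          X 0 ^ 3 * (1 + X 2 ^ 2 * X 3 * (X 1 ^ 4 + 1)) ∧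
        (∀ (𝔮 : Ideal (MvPolynomial (Fin 4) K)) [𝔮.IsPrime], ∀ s ∉ 𝔮,
          s * (X 0 ^ 3 + X 3 * (X 1 ^ 4 + 1) : MvPolynomial (Fin 4) K) ∈ 𝔮 ^ 3 → False) ∧
        (∀ (𝔮 : Ideal (MvPolynomial (Fin 4) K)) [𝔮.IsPrime], ∀ s ∉ 𝔮,
          s * (X 0 ^ 3 + X 2 ^ 2 * (X 1 ^ 4 + 1) : MvPolynomial (Fin 4) K) ∈ 𝔮 ^ 3 → (X 1 ^ 4 + 1 : MvPolynomial (Fin 4) K) ∈ 𝔮) ∧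
        (∀ (𝔮 : Ideal (MvPolynomial (Fin 4) K)) [𝔮.IsPrime], ∀ s ∉ 𝔮,
          s * (1 + X 2 ^ 2 * X 3 * (X 1 ^ 4 + 1) : MvPolynomial (Fin 4) K) ∈ 𝔮 ^ 3 → False)) ∧
      (aeval (fun j : Fin 4 => if j = 0 then X 0 * (X 1 ^ 4 + 1) else if j = 2 then X 2 * (X 1 ^ 4 + 1) else (X j : MvPolynomial (Fin 4) K))
            (X 0 ^ 3 + X 2 ^ 2 * X 3 * (X 1 ^ 4 + 1) : MvPolynomial (Fin 4) K) =
          (X 1 ^ 4 + 1) ^ 3 * (X 0 ^ 3 + X 2 ^ 2 * X 3) ∧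
        (∀ (𝔮 : Ideal (MvPolynomial (Fin 4) K)) [𝔮.IsPrime], ∀ s ∉ 𝔮,
          s * (X 0 ^ 3 + X 2 ^ 2 * X 3 : MvPolynomial (Fin 4) K) ∈ 𝔮 ^ 3 → (X 3 : MvPolynomial (Fin 4) K) ∈ 𝔮)) :=
  ⟨⟨Cx_D_lineChart_X2, Cx_D_lineChart_X3, Cx_D_lineChart_X0, fun 𝔮 _ _ hs h => Cx_D_lineChart_X2_noTop 𝔮 hs h,
      fun 𝔮 _ _ hs h => Cx_D_lineChart_X3_top 𝔮 hs h, fun 𝔮 _ _ hs h => Cx_D_lineChart_X0_noTop 𝔮 hs h⟩,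
    ⟨Cx_D_muChart_h, fun 𝔮 _ _ hs h => Cx_D_muChart_h_top 𝔮 hs h⟩⟩

/-- **C× · R3 → R4 off the bad fibres, `ν`-charts** `b` / `α` / `γ` (blow-up of `ν` in chart-`b` coordinates): top
only over `Q₀` (`w' ∈ 𝔮`), or on
`μ` away from `ν` (`1+γ⁴ ∈ 𝔮`): NO top point over `ν ∖ Q₀`.  With `Cx_R4_certificate` and P∞ over `Q`, `Q₀`: bad₄ =
∅ — the refined run of C×
TERMINATES at refined height 4. [new] [folklore] -/
theorem Cx_R4nu_certificate [CharP K 3] :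
      aeval (linChartSubst (K := K) {0, 1, 2} 1) (X 0 ^ 3 + X 1 ^ 2 * X 2 * X 3 * (1 + X 2 ^ 4) : MvPolynomial (Fin 4) K) =
          X 1 ^ 3 * (X 0 ^ 3 + X 2 * X 3 * (1 + X 2 ^ 4 * X 1 ^ 4)) ∧
        aeval (linChartSubst (K := K) {0, 1, 2} 0) (X 0 ^ 3 + X 1 ^ 2 * X 2 * X 3 * (1 + X 2 ^ 4) : MvPolynomial (Fin 4) K) =
          X 0 ^ 3 * (1 + X 1 ^ 2 * X 2 * X 3 * (1 + X 2 ^ 4 * X 0 ^ 4)) ∧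
        aeval (linChartSubst (K := K) {0, 1, 2} 2) (X 0 ^ 3 + X 1 ^ 2 * X 2 * X 3 * (1 + X 2 ^ 4) : MvPolynomial (Fin 4) K) =
          X 2 ^ 3 * (X 0 ^ 3 + X 1 ^ 2 * X 3 * (1 + X 2 ^ 4)) ∧
        (∀ (𝔮 : Ideal (MvPolynomial (Fin 4) K)) [𝔮.IsPrime], ∀ s ∉ 𝔮,
          s * (X 0 ^ 3 + X 2 * X 3 * (1 + X 2 ^ 4 * X 1 ^ 4) : MvPolynomial (Fin 4) K) ∈ 𝔮 ^ 3 → (X 3 : MvPolynomial (Fin 4) K) ∈ 𝔮) ∧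
        (∀ (𝔮 : Ideal (MvPolynomial (Fin 4) K)) [𝔮.IsPrime], ∀ s ∉ 𝔮,
          s * (1 + X 1 ^ 2 * X 2 * X 3 * (1 + X 2 ^ 4 * X 0 ^ 4) : MvPolynomial (Fin 4) K) ∈ 𝔮 ^ 3 → False) ∧
        (∀ (𝔮 : Ideal (MvPolynomial (Fin 4) K)) [𝔮.IsPrime], ∀ s ∉ 𝔮,
          s * (X 0 ^ 3 + X 1 ^ 2 * X 3 * (1 + X 2 ^ 4) : MvPolynomial (Fin 4) K) ∈ 𝔮 ^ 3 →
            (X 3 : MvPolynomial (Fin 4) K) ∈ 𝔮 ∨ (1 + X 2 ^ 4 : MvPolynomial (Fin 4) K) ∈ 𝔮) :=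
  ⟨Cx_D_nuChart_X1, Cx_D_nuChart_X0, Cx_D_nuChart_X2, fun 𝔮 _ _ hs h => Cx_D_nuChart_X1_top 𝔮 hs h,
    fun 𝔮 _ _ hs h => Cx_D_nuChart_X0_noTop 𝔮 hs h, fun 𝔮 _ _ hs h => Cx_D_nuChart_X2_top 𝔮 hs h⟩

end RefCertificates

end Summit.ResolutionOfSingularities.ResolutionOfSingularities.Theorems.DeltaCutClasses
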